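import Summits.CriticalPhenomena.PercolationContinuityZ3.Theorems.PercNearOneGluingNoHeavyLowerTailMajorityGluingTypeBridgeLaw
import Literature.Probability.Percolation.BergKahnLogSupermodular
import HarnessLib

/-!
# The TYPE BRIDGE, part VI: the 24 quadratic van den Berg–Kahn rows of `SymLaw` hold for the law of the hub gadget (lane prim-rate, constants-miner 1, gen 31; CANDIDATES §GEN-18 R157, §GEN-31)

Support file for the closed crux `NoHeavyLowerTail` (stmt-CriticalPhenomena-4575), majority-gluing line.  The two quadratic row families of
`HubOnly.TypeTable.SymLaw` — the HUB rows `T_a·T_b ≤ C_{ab}·AC` and the RELAY-ROOT rows `(C_{rz} + P_{rz})·T_r ≤ C_{rz}·(T_r + S_r)` — are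
instances of van den Berg–Kahn (2001) Thm 1.2 (`BergKahn.bergKahn_thm_1_2`, a tree theorem:
`P(s ↔ A, s ↮ X)·P(s ↔ B, s ↮ Y) ≤ P(s ↔ A ∪ B, s ↮ X ∩ Y)·P(s ↮ X ∪ Y)`) rooted at the hub resp. at the relay `v r`, once the layer events of
the type (`isT`, `isC`, `allCut`, `isP`, `isS` at `typeOf ω`) are identified with configuration events (`events_spec`, by kernel evaluation over the
shapes, + part II).  Results: `hub_law`, `rel_law` — the fields `hub`, `rel` of `SymLaw` for `law w a v M`.  No sorries.
[cite: VandenbergKahn2001, Thm 1.2 (p. 123)]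
-/

noncomputable section

namespace Summit.CriticalPhenomena.PercolationContinuityZ3.Theorems

open MeasureTheory Set
open Literature.Probability.LatticeModels (prodBernoulli)
open Literature.Probability.Percolation

namespace HubOnly
namespace TypeTable

/-- The two relays of `{1,2,3,4}` other than `w, z` (as a list). -/
def others (w z : ℕ) : List ℕ := [1, 2, 3, 4].filter fun y => !(y == w) && !(y == z)

/-- **The layer events at the canonical type of a valid shape, in terms of the shape** (one kernel evaluation over the `2¹⁰` shapes):
`T_z` = «`z` attached, the others cut», `C_{wz}` = «`w, z` attached, the others cut», `AC` = «all cut», `P_{wz}` = «`w` cut, `z ∈ B_w`, the others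
`∉ B_w`», `S_z` = «`z` cut, no other relay in `B_z`». -/
theorem events_spec_bool : ∀ s12 s13 s14 s23 s24 s34 c1 c2 c3 c4 : Bool,
    (⟨s12, s13, s14, s23, s24, s34, c1, c2, c3, c4⟩ : Shape).valid = true →
    ((∀ z ∈ [1, 2, 3, 4], (⟨s12, s13, s14, s23, s24, s34, c1, c2, c3, c4⟩ : Shape).toType.isT z =
        (!(⟨s12, s13, s14, s23, s24, s34, c1, c2, c3, c4⟩ : Shape).cutf z &&
          (others z z).all (⟨s12, s13, s14, s23, s24, s34, c1, c2, c3, c4⟩ : Shape).cutf)) ∧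
     (∀ w' ∈ [1, 2, 3, 4], ∀ z ∈ [1, 2, 3, 4], w' ≠ z →
        (⟨s12, s13, s14, s23, s24, s34, c1, c2, c3, c4⟩ : Shape).toType.isC w' z =
        (!(⟨s12, s13, s14, s23, s24, s34, c1, c2, c3, c4⟩ : Shape).cutf w' &&
          !(⟨s12, s13, s14, s23, s24, s34, c1, c2, c3, c4⟩ : Shape).cutf z &&
          (others w' z).all (⟨s12, s13, s14, s23, s24, s34, c1, c2, c3, c4⟩ : Shape).cutf)) ∧
     ((⟨s12, s13, s14, s23, s24, s34, c1, c2, c3, c4⟩ : Shape).toType.allCut =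
        [1, 2, 3, 4].all (⟨s12, s13, s14, s23, s24, s34, c1, c2, c3, c4⟩ : Shape).cutf) ∧
     (∀ w' ∈ [1, 2, 3, 4], ∀ z ∈ [1, 2, 3, 4], w' ≠ z →
        (⟨s12, s13, s14, s23, s24, s34, c1, c2, c3, c4⟩ : Shape).toType.isP w' z =
        ((⟨s12, s13, s14, s23, s24, s34, c1, c2, c3, c4⟩ : Shape).cutf w' &&
          (⟨s12, s13, s14, s23, s24, s34, c1, c2, c3, c4⟩ : Shape).same w' z &&
          (others w' z).all fun y => !(⟨s12, s13, s14, s23, s24, s34, c1, c2, c3, c4⟩ : Shape).same w' y)) ∧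
     (∀ z ∈ [1, 2, 3, 4], (⟨s12, s13, s14, s23, s24, s34, c1, c2, c3, c4⟩ : Shape).toType.isS z =
        ((⟨s12, s13, s14, s23, s24, s34, c1, c2, c3, c4⟩ : Shape).cutf z &&
          (others z z).all fun y => !(⟨s12, s13, s14, s23, s24, s34, c1, c2, c3, c4⟩ : Shape).same z y))) := by
  decide +kernel

/-- The layer events at the canonical type of a valid shape. -/
theorem events_spec (σ : Shape) (hσ : σ.valid = true) :
    (∀ z ∈ [1, 2, 3, 4], σ.toType.isT z = (!σ.cutf z && (others z z).all σ.cutf)) ∧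
    (∀ w' ∈ [1, 2, 3, 4], ∀ z ∈ [1, 2, 3, 4], w' ≠ z → σ.toType.isC w' z = (!σ.cutf w' && !σ.cutf z && (others w' z).all σ.cutf)) ∧
    (σ.toType.allCut = [1, 2, 3, 4].all σ.cutf) ∧
    (∀ w' ∈ [1, 2, 3, 4], ∀ z ∈ [1, 2, 3, 4], w' ≠ z →
      σ.toType.isP w' z = (σ.cutf w' && σ.same w' z && (others w' z).all fun y => !σ.same w' y)) ∧
    (∀ z ∈ [1, 2, 3, 4], σ.toType.isS z = (σ.cutf z && (others z z).all fun y => !σ.same z y)) := by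
  obtain ⟨s12, s13, s14, s23, s24, s34, c1, c2, c3, c4⟩ := σ
  exact events_spec_bool s12 s13 s14 s23 s24 s34 c1 c2 c3 c4 hσ

/-- Membership in `others`. -/
theorem mem_others {w z y : ℕ} : y ∈ others w z ↔ y ∈ [1, 2, 3, 4] ∧ y ≠ w ∧ y ≠ z := by
  simp [others]

namespace Bridge

open Refresh
open scoped Classical

variable {n : ℕ}

section Events

variable (a : Fin n) (v : ℕ → Fin n) (hv : ∀ x ∈ [1, 2, 3, 4], v x ≠ a)
include hv

/-- **`T_z` at `typeOf ω`** is «`v z` attached and every other relay cut». -/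
theorem isT_typeOf (ω : BondConfig (Fin n)) {z : ℕ} (hz : z ∈ [1, 2, 3, 4]) :
    (typeOf a v ω).isT z = true ↔
      ((openGraph ω).Reachable a (v z) ∧ ∀ y ∈ [1, 2, 3, 4], y ≠ z → ¬ (openGraph ω).Reachable a (v y)) := by
  rw [typeOf, (events_spec _ (shapeOf_valid a v hv ω)).1 z hz]
  simp only [Bool.and_eq_true, Bool.not_eq_true', List.all_eq_true, mem_others, shapeOf_cutf a v ω z hz, decide_eq_false_iff_not,
    not_not]
  constructor
  · rintro ⟨h1, h2⟩
    refine ⟨h1, fun y hy hyz => ?_⟩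
    have := h2 y ⟨hy, hyz, hyz⟩
    rwa [shapeOf_cutf a v ω y hy, decide_eq_true_eq] at this
  · rintro ⟨h1, h2⟩
    refine ⟨h1, fun y ⟨hy, hyz, _⟩ => ?_⟩
    rw [shapeOf_cutf a v ω y hy, decide_eq_true_eq]; exact h2 y hy hyz

/-- **`C_{w'z}` at `typeOf ω`** is «`v w', v z` attached and the other two relays cut». -/
theorem isC_typeOf (ω : BondConfig (Fin n)) {w' z : ℕ} (hw : w' ∈ [1, 2, 3, 4]) (hz : z ∈ [1, 2, 3, 4]) (hwz : w' ≠ z) :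
    (typeOf a v ω).isC w' z = true ↔
      ((openGraph ω).Reachable a (v w') ∧ (openGraph ω).Reachable a (v z) ∧
        ∀ y ∈ [1, 2, 3, 4], y ≠ w' → y ≠ z → ¬ (openGraph ω).Reachable a (v y)) := by
  rw [typeOf, (events_spec _ (shapeOf_valid a v hv ω)).2.1 w' hw z hz hwz]
  simp only [Bool.and_eq_true, Bool.not_eq_true', List.all_eq_true, mem_others, shapeOf_cutf a v ω w' hw, shapeOf_cutf a v ω z hz,
    decide_eq_false_iff_not, not_not]
  constructor
  · rintro ⟨⟨h1, h2⟩, h3⟩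
    refine ⟨h1, h2, fun y hy hyw hyz => ?_⟩
    have := h3 y ⟨hy, hyw, hyz⟩
    rwa [shapeOf_cutf a v ω y hy, decide_eq_true_eq] at this
  · rintro ⟨h1, h2, h3⟩
    refine ⟨⟨h1, h2⟩, fun y ⟨hy, hyw, hyz⟩ => ?_⟩
    rw [shapeOf_cutf a v ω y hy, decide_eq_true_eq]; exact h3 y hy hyw hyz

/-- **`AC` at `typeOf ω`** is «all four relays cut». -/
theorem allCut_typeOf (ω : BondConfig (Fin n)) :
    (typeOf a v ω).allCut = true ↔ ∀ y ∈ [1, 2, 3, 4], ¬ (openGraph ω).Reachable a (v y) := by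
  rw [typeOf, (events_spec _ (shapeOf_valid a v hv ω)).2.2.1]
  simp only [List.all_eq_true]
  constructor
  · intro h y hy; have := h y hy; rwa [shapeOf_cutf a v ω y hy, decide_eq_true_eq] at this
  · intro h y hy; rw [shapeOf_cutf a v ω y hy, decide_eq_true_eq]; exact h y hy

/-- **`P_{w'z}` at `typeOf ω`** is «`v w'` cut, `v z ∈ B_{w'}`, the other two relays outside `B_{w'}`». -/
theorem isP_typeOf (ω : BondConfig (Fin n)) {w' z : ℕ} (hw : w' ∈ [1, 2, 3, 4]) (hz : z ∈ [1, 2, 3, 4]) (hwz : w' ≠ z) :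
    (typeOf a v ω).isP w' z = true ↔
      (¬ (openGraph ω).Reachable a (v w') ∧ v z ∈ clusOff {a} ω (v w') ∧
        ∀ y ∈ [1, 2, 3, 4], y ≠ w' → y ≠ z → v y ∉ clusOff {a} ω (v w')) := by
  rw [typeOf, (events_spec _ (shapeOf_valid a v hv ω)).2.2.2.1 w' hw z hz hwz]
  simp only [Bool.and_eq_true, Bool.not_eq_true', List.all_eq_true, mem_others, shapeOf_cutf a v ω w' hw,
    shapeOf_same a v ω w' hw z hz, decide_eq_true_eq]
  constructor
  · rintro ⟨⟨h1, h2⟩, h3⟩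
    refine ⟨h1, h2, fun y hy hyw hyz => ?_⟩
    have := h3 y ⟨hy, hyw, hyz⟩
    rwa [shapeOf_same a v ω w' hw y hy, decide_eq_false_iff_not] at this
  · rintro ⟨h1, h2, h3⟩
    refine ⟨⟨h1, h2⟩, fun y ⟨hy, hyw, hyz⟩ => ?_⟩
    rw [shapeOf_same a v ω w' hw y hy, decide_eq_false_iff_not]; exact h3 y hy hyw hyz

/-- **`S_z` at `typeOf ω`** is «`v z` cut and no other relay in `B_z`». -/
theorem isS_typeOf (ω : BondConfig (Fin n)) {z : ℕ} (hz : z ∈ [1, 2, 3, 4]) :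
    (typeOf a v ω).isS z = true ↔
      (¬ (openGraph ω).Reachable a (v z) ∧ ∀ y ∈ [1, 2, 3, 4], y ≠ z → v y ∉ clusOff {a} ω (v z)) := by
  rw [typeOf, (events_spec _ (shapeOf_valid a v hv ω)).2.2.2.2 z hz]
  simp only [Bool.and_eq_true, List.all_eq_true, mem_others, shapeOf_cutf a v ω z hz, decide_eq_true_eq]
  constructor
  · rintro ⟨h1, h2⟩
    refine ⟨h1, fun y hy hyz => ?_⟩
    have := h2 y ⟨hy, hyz, hyz⟩
    rwa [shapeOf_same a v ω z hz y hy, Bool.not_eq_true', decide_eq_false_iff_not] at this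
  · rintro ⟨h1, h2⟩
    refine ⟨h1, fun y ⟨hy, hyz, _⟩ => ?_⟩
    rw [shapeOf_same a v ω z hz y hy, Bool.not_eq_true', decide_eq_false_iff_not]; exact h2 y hy hyz

end Events

/-! ### The hub rows -/

/-- **THE HUB ROWS** `T_a·T_b ≤ C_{ab}·AC` for the law of the hub gadget: van den Berg–Kahn Thm 1.2 rooted at the hub with `A = {v a}`,
`X = the other relays`, `B = {v b}`, `Y = the other relays`. [cite: VandenbergKahn2001, Thm 1.2 (p. 123)] -/
theorem hub_law (w : Sym2 (Fin n) → unitInterval) (a : Fin n) (v : ℕ → Fin n) (hv : ∀ x ∈ [1, 2, 3, 4], v x ≠ a) {M : ℝ} (hM : 0 < M) :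
    ∀ z₁ ∈ [1, 2, 3, 4], ∀ z₂ ∈ [1, 2, 3, 4], z₁ ≠ z₂ →
      Tm z₁ (law w a v M) * Tm z₂ (law w a v M) ≤ Cm z₁ z₂ (law w a v M) * ACm (law w a v M) := by
  intro z₁ h1 z₂ h2 h12
  set μ := prodBernoulli w with hμ
  simp only [Tm, Cm, ACm, lin_ind_law w a v hv]
  rw [div_mul_div_comm, div_mul_div_comm]
  refine div_le_div_of_nonneg_right ?_ (mul_pos hM hM).le
  -- the four events in root form at the hub
  set X : ℕ → Set (Fin n) := fun z => {u | ∃ y ∈ [1, 2, 3, 4], y ≠ z ∧ u = v y} with hX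
  have hT : ∀ z ∈ [1, 2, 3, 4], {ω : BondConfig (Fin n) | (typeOf a v ω).isT z = true} =
      {ω : BondConfig (Fin n) | ∀ a' ∈ ({v z} : Set (Fin n)), ω ∈ openConn a a'} ∩ {ω | ∀ x ∈ X z, ω ∉ openConn a x} := by
    intro z hz; ext ω
    rw [mem_setOf_eq, isT_typeOf a v hv ω hz]
    simp only [mem_inter_iff, mem_setOf_eq, Set.mem_singleton_iff, forall_eq, openConn, hX]
    constructor
    · rintro ⟨hr, hc⟩; exact ⟨hr, fun x ⟨y, hy, hyz, hx⟩ => hx ▸ hc y hy hyz⟩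
    · rintro ⟨hr, hc⟩; exact ⟨hr, fun y hy hyz => hc _ ⟨y, hy, hyz, rfl⟩⟩
  have hBK := BergKahn.bergKahn_thm_1_2 w a ({v z₁} : Set (Fin n)) ({v z₂} : Set (Fin n)) (X z₁) (X z₂)
  rw [← hT z₁ h1, ← hT z₂ h2] at hBK
  refine hBK.trans (mul_le_mul ?_ ?_ measureReal_nonneg measureReal_nonneg)
  · refine measureReal_mono (fun ω hω => ?_) (measure_ne_top _ _)
    obtain ⟨hq, hr⟩ := hω
    rw [mem_setOf_eq, isC_typeOf a v hv ω h1 h2 h12]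
    refine ⟨hq _ (Or.inl rfl), hq _ (Or.inr rfl), fun y hy hy1 hy2 => hr _ ⟨⟨y, hy, hy1, rfl⟩, ⟨y, hy, hy2, rfl⟩⟩⟩
  · refine measureReal_mono (fun ω hω => ?_) (measure_ne_top _ _)
    rw [mem_setOf_eq, allCut_typeOf a v hv ω]
    intro y hy
    by_cases hy1 : y = z₁
    · exact hω _ (Or.inr ⟨y, hy, fun h => h12 (hy1.symm.trans h), rfl⟩)
    · exact hω _ (Or.inl ⟨y, hy, hy1, rfl⟩)

/-! ### The relay-root rows -/

/-- **THE RELAY-ROOT ROWS** `(C_{rz} + P_{rz})·T_r ≤ C_{rz}·(T_r + S_r)` (i.e. `P_{rz}·T_r ≤ C_{rz}·S_r`) for the law of the hub gadget: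
van den Berg–Kahn Thm 1.2 rooted at `v r` with `A = {v z}`, `X = {a} ∪ others`, `B = {a}`, `Y = {v z} ∪ others`.
[cite: VandenbergKahn2001, Thm 1.2 (p. 123)] -/
theorem rel_law (w : Sym2 (Fin n) → unitInterval) (a : Fin n) (v : ℕ → Fin n) (hv : ∀ x ∈ [1, 2, 3, 4], v x ≠ a) {M : ℝ} (hM : 0 < M) :
    ∀ r ∈ [1, 2, 3, 4], ∀ z ∈ [1, 2, 3, 4], r ≠ z →
      (Cm r z (law w a v M) + Pm r z (law w a v M)) * Tm r (law w a v M) ≤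
        Cm r z (law w a v M) * (Tm r (law w a v M) + Sm r (law w a v M)) := by
  intro r hr z hz hrz
  set μ := prodBernoulli w with hμ
  suffices key : Pm r z (law w a v M) * Tm r (law w a v M) ≤ Cm r z (law w a v M) * Sm r (law w a v M) by nlinarith
  simp only [Tm, Cm, Pm, Sm, lin_ind_law w a v hv]
  rw [div_mul_div_comm, div_mul_div_comm]
  refine div_le_div_of_nonneg_right ?_ (mul_pos hM hM).le
  set O : Set (Fin n) := {u | ∃ y ∈ [1, 2, 3, 4], y ≠ r ∧ y ≠ z ∧ u = v y} with hO
  have hBK := BergKahn.bergKahn_thm_1_2 w (v r) ({v z} : Set (Fin n)) ({a} : Set (Fin n)) ({a} ∪ O) ({v z} ∪ O)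
  -- `P_{rz}` = `Q_{v z} ∩ R_{{a} ∪ O}` rooted at `v r`
  have hP : {ω : BondConfig (Fin n) | (typeOf a v ω).isP r z = true} =
      {ω : BondConfig (Fin n) | ∀ a' ∈ ({v z} : Set (Fin n)), ω ∈ openConn (v r) a'} ∩ {ω | ∀ x ∈ ({a} ∪ O : Set (Fin n)), ω ∉ openConn (v r) x} := by
    ext ω
    rw [mem_setOf_eq, isP_typeOf a v hv ω hr hz hrz]
    simp only [mem_inter_iff, mem_setOf_eq, Set.mem_singleton_iff, forall_eq, mem_union, openConn, hO]
    constructor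
    · rintro ⟨hcut, hzB, hoth⟩
      have hreach : ∀ y, (openGraph ω).Reachable (v r) (v y) ↔ v y ∈ clusOff {a} ω (v r) := fun y => by
        rw [reachable_relays_iff (a := a)]; exact ⟨fun h => h.resolve_right fun h' => hcut h'.1, fun h => Or.inl h⟩
      refine ⟨(hreach z).2 hzB, fun x hx => ?_⟩
      rcases hx with rfl | ⟨y, hy, hyr, hyz, rfl⟩
      · exact fun h => hcut h.symm
      · rw [hreach y]; exact hoth y hy hyr hyz
    · rintro ⟨hrz', hX⟩
      have hcut : ¬ (openGraph ω).Reachable a (v r) := fun h => hX a (Or.inl rfl) h.symm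
      have hreach : ∀ y, (openGraph ω).Reachable (v r) (v y) ↔ v y ∈ clusOff {a} ω (v r) := fun y => by
        rw [reachable_relays_iff (a := a)]; exact ⟨fun h => h.resolve_right fun h' => hcut h'.1, fun h => Or.inl h⟩
      exact ⟨hcut, (hreach z).1 hrz', fun y hy hyr hyz => by rw [← hreach y]; exact hX _ (Or.inr ⟨y, hy, hyr, hyz, rfl⟩)⟩
  -- `T_r` = `Q_{a} ∩ R_{{v z} ∪ O}` rooted at `v r`
  have hT : {ω : BondConfig (Fin n) | (typeOf a v ω).isT r = true} =
      {ω : BondConfig (Fin n) | ∀ a' ∈ ({a} : Set (Fin n)), ω ∈ openConn (v r) a'} ∩ {ω | ∀ x ∈ ({v z} ∪ O : Set (Fin n)), ω ∉ openConn (v r) x} := by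
    ext ω
    rw [mem_setOf_eq, isT_typeOf a v hv ω hr]
    simp only [mem_inter_iff, mem_setOf_eq, Set.mem_singleton_iff, forall_eq, mem_union, openConn, hO]
    constructor
    · rintro ⟨hra, hoth⟩
      refine ⟨hra.symm, fun x hx => ?_⟩
      rcases hx with rfl | ⟨y, hy, hyr, -, rfl⟩
      · exact fun h => hoth z hz (Ne.symm hrz) (hra.trans h)
      · exact fun h => hoth y hy hyr (hra.trans h)
    · rintro ⟨hra, hX⟩
      refine ⟨hra.symm, fun y hy hyr h => ?_⟩
      by_cases hyz : y = z
      · subst hyz; exact hX _ (Or.inl rfl) (hra.trans h)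
      · exact hX _ (Or.inr ⟨y, hy, hyr, hyz, rfl⟩) (hra.trans h)
  rw [← hP, ← hT] at hBK
  refine hBK.trans (mul_le_mul ?_ ?_ measureReal_nonneg measureReal_nonneg)
  · refine measureReal_mono (fun ω hω => ?_) (measure_ne_top _ _)
    obtain ⟨hq, hx⟩ := hω
    rw [mem_setOf_eq, isC_typeOf a v hv ω hr hz hrz]
    have hra : (openGraph ω).Reachable (v r) a := hq a (Or.inr rfl)
    refine ⟨hra.symm, hra.symm.trans (hq _ (Or.inl rfl)), fun y hy hyr hyz h => ?_⟩
    exact hx (v y) ⟨Or.inr ⟨y, hy, hyr, hyz, rfl⟩, Or.inr ⟨y, hy, hyr, hyz, rfl⟩⟩ (hra.trans h)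
  · refine measureReal_mono (fun ω hω => ?_) (measure_ne_top _ _)
    rw [mem_setOf_eq, isS_typeOf a v hv ω hr]
    have hcut : ¬ (openGraph ω).Reachable a (v r) := fun h => hω a (Or.inl (Or.inl rfl)) h.symm
    refine ⟨hcut, fun y hy hyr hyB => ?_⟩
    have hreach : (openGraph ω).Reachable (v r) (v y) := (reachable_relays_iff (a := a)).2 (Or.inl hyB)
    by_cases hyz : y = z
    · subst hyz; exact hω _ (Or.inr (Or.inl rfl)) hreach
    · exact hω _ (Or.inr (Or.inr ⟨y, hy, hyr, hyz, rfl⟩)) hreach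

end Bridge
end TypeTable
end HubOnly
end Summit.CriticalPhenomena.PercolationContinuityZ3.Theorems
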